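/-
Copyright (c) 2026. Released under Apache 2.0 license.
-/
import Literature.NumberTheory.LFunctions.WeilTwoPrimeCellsT80NuSplit
import Literature.NumberTheory.LFunctions.WeilTwoPrimeCellsT80CheckAll
import Literature.NumberTheory.LFunctions.WeilFirstPrimeCertificateZ
import HarnessLib

/-!
# Semi-local threshold `a*({2})`, lower rung `b = 277/500`: ONE-prime cells from the TWO-prime chain on `[0, 80]`

Cell `rh-explicit` (HOME `run/shared/lean/pub/rh-explicit/`), seat cc-s2-2, block C⁺/B2.  The one-prime Stage-C
certificate format `WeilCert3` (`WeilFirstPrimeCertificateZ.lean`) needs a chain of first-prime cells (`FPDCell`)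
minorising `w₂(t) = Re ψ(1/4+it/2) − √2 log 2 cos(t log 2)`.  The tree's two-prime chain `weilTwoPrimeCellsT80`
(248 cells `TPDCell` on `[0, 80]`, `WeilTwoPrimeCellsT80*.lean`) CONTAINS one: a two-prime cell is a first-prime cell
`c.fp` plus a `log 3` ripple, and `TPDCell.checkZ p j = c.fp.checkZ p j ∧ …`.  This file (pure bookkeeping, proved):

* `cellsT80fp := weilTwoPrimeCellsT80.map TPDCell.fp` passes the first-prime cell checks at `prec = 120`, `j = 5`
  (`all_checkZ_cellsT80fp`, from the tree's kernel facts `weilTwoPrimeCellsT80_check*`), and chains `0 → 80`;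
* the SPLIT of its moments at ANY level `wL'` into the two-prime chain's kernel-verified partial sums at the chain's own
  level (`nuPartT80_t_q`, `WeilTwoPrimeCellsT80NuFact*.lean`), a level-shift term and the `log 3`-ripple moments:
  `cellsMomentQ₂ wL' (L.map fp) q = cellsMomentQ₂₃ wL L q + (wL' − wL)·powSum L (q+1) + ripple3Sum L q`
  (`cellsMomentQ₂_map_fp`; per cell `TPDCell.momentQ` is DEFINED as `fp.momentQ −` the ripple-3 part, and
  `WeilCell.momentQ` is affine in the level), and the resulting entry test `WeilCert3.checkNuAt_of_partsT80fp` for every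
  Stage-C certificate whose cells are `cellsT80fp`: four two-prime partial sums + two cheap one-prime kernel facts + one
  inequality between literals per entry, instead of re-deriving `≈ 250` cell moments per entry in the kernel.
-/

set_option linter.dupNamespace false  -- the mandated namespace repeats `RiemannHypothesis`

namespace Summit.RiemannHypothesis.RiemannHypothesis.Theorems.SemilocalCert554

open Literature.NumberTheory.LFunctions
open Literature.Analysis.ValidatedNumerics.Numerics

/-- The one-prime cells of the two-prime chain on `[0, 80]`: its inner `FPDCell`s. [folklore] -/
noncomputable def cellsT80fp : List FPDCell := weilTwoPrimeCellsT80.map TPDCell.fp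

/-- The `log 3`-ripple part of the moment of a two-prime cell: `Σ_k p₃,k ∫_u^v (s − u)^k s^q ds`. [folklore] -/
noncomputable def ripple3MomentQ (c : TPDCell) (q : ℕ) : ℚ :=
  sumR (c.n3 + 1) fun k ↦ getV c.cosPart3 k * c.fp.shiftPowIntQ k q

/-- Sum of the `log 3`-ripple moments over a list of two-prime cells. [folklore] -/
noncomputable def ripple3Sum : List TPDCell → ℕ → ℚ
  | [], _ => 0
  | c :: cs, q => ripple3MomentQ c q + ripple3Sum cs q

/-- `Σ_cells ∫_u^v s^{e-1} ds = Σ (v^e − u^e)/e` over a list of two-prime cells. [folklore] -/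
noncomputable def powSum : List TPDCell → ℕ → ℚ
  | [], _ => 0
  | c :: cs, e => c.fp.psi.powIntQ e + powSum cs e

/-- Per cell: the first-prime moment at level `wL'` is the two-prime moment at level `wL` plus the level shift plus the
`log 3`-ripple part (both by unfolding the definitions). [folklore] -/
theorem fp_momentQ_eq (c : TPDCell) (wL wL' : ℚ) (q : ℕ) :
    c.fp.momentQ wL' q = c.momentQ wL q + (wL' - wL) * c.fp.psi.powIntQ (q + 1) + ripple3MomentQ c q := by
  unfold TPDCell.momentQ ripple3MomentQ FPDCell.momentQ WeilCell.momentQ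
  ring

/-- **The moment split** over a list of two-prime cells. [folklore] -/
theorem cellsMomentQ₂_map_fp (L : List TPDCell) (wL wL' : ℚ) (q : ℕ) :
    cellsMomentQ₂ wL' (L.map TPDCell.fp) q =
      cellsMomentQ₂₃ wL L q + (wL' - wL) * powSum L (q + 1) + ripple3Sum L q := by
  induction L with
  | nil => simp [cellsMomentQ₂, cellsMomentQ₂₃, powSum, ripple3Sum]
  | cons c cs ih =>
    simp only [List.map_cons, cellsMomentQ₂, cellsMomentQ₂₃, powSum, ripple3Sum, ih, fp_momentQ_eq c wL wL' q]
    ring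

/-- `ripple3Sum` is additive over concatenation. [folklore] -/
theorem ripple3Sum_append (A B : List TPDCell) (q : ℕ) :
    ripple3Sum (A ++ B) q = ripple3Sum A q + ripple3Sum B q := by
  induction A with
  | nil => simp [ripple3Sum]
  | cons c cs ih => simp only [List.cons_append, ripple3Sum, ih, add_assoc]

/-- `powSum` is additive over concatenation. [folklore] -/
theorem powSum_append (A B : List TPDCell) (e : ℕ) :
    powSum (A ++ B) e = powSum A e + powSum B e := by
  induction A with
  | nil => simp [powSum]
  | cons c cs ih => simp only [List.cons_append, powSum, ih, add_assoc]

/-- **One entry of the moment check of a Stage-C certificate on the cells `cellsT80fp`, from parts.**  If the four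
two-prime chunk sums at the chain's level have the values `v₀ … v₃` (the tree's kernel facts `nuPartT80_t_q_eq`), the
ripple-3 sums over the three data chunks have the values `r₀, r₁, r₂`, the power sums the values `s₀, s₁, s₂`, and the
claimed entry passes the literal test, then `c.checkNuAt q`. [folklore] -/
theorem _root_.Literature.NumberTheory.LFunctions.WeilCert3.checkNuAt_of_partsT80fp (c : WeilCert3)
    (hcells : c.cells = cellsT80fp) (q : ℕ) (v₀ v₁ v₂ v₃ r₀ r₁ r₂ s₀ s₁ s₂ : ℚ)
    (h₀ : cellsMomentQ₂₃ weilTwoPrimeCellsT80Level weilTwoPrimeCellsT80C0 q = v₀)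
    (h₁ : cellsMomentQ₂₃ weilTwoPrimeCellsT80Level (weilTwoPrimeCellsT80C1.take 53) q = v₁)
    (h₂ : cellsMomentQ₂₃ weilTwoPrimeCellsT80Level (weilTwoPrimeCellsT80C1.drop 53) q = v₂)
    (h₃ : cellsMomentQ₂₃ weilTwoPrimeCellsT80Level weilTwoPrimeCellsT80C2 q = v₃)
    (hr₀ : ripple3Sum weilTwoPrimeCellsT80C0 q = r₀) (hr₁ : ripple3Sum weilTwoPrimeCellsT80C1 q = r₁)
    (hr₂ : ripple3Sum weilTwoPrimeCellsT80C2 q = r₂)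
    (hs₀ : powSum weilTwoPrimeCellsT80C0 (q + 1) = s₀) (hs₁ : powSum weilTwoPrimeCellsT80C1 (q + 1) = s₁)
    (hs₂ : powSum weilTwoPrimeCellsT80C2 (q + 1) = s₂)
    (hlit : |getV c.nuData q - nuScale * (c.base.a0 ^ q * (2 * ((v₀ + v₁ + v₂ + v₃) +
        (c.base.wL - weilTwoPrimeCellsT80Level) * (s₀ + s₁ + s₂) + (r₀ + r₁ + r₂))))| ≤ 1 / 2 ^ c.pnu) :
    c.checkNuAt q = true := by
  unfold WeilCert3.checkNuAt WeilCert3.nuQ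
  rw [decide_eq_true_eq, hcells, cellsT80fp, cellsMomentQ₂_map_fp _ weilTwoPrimeCellsT80Level,
    cellsMomentQ₂₃_T80_split, h₀, h₁, h₂, h₃]
  have hr : ripple3Sum weilTwoPrimeCellsT80 q = r₀ + r₁ + r₂ := by
    rw [weilTwoPrimeCellsT80, ripple3Sum_append, ripple3Sum_append, hr₀, hr₁, hr₂]
  have hs : powSum weilTwoPrimeCellsT80 (q + 1) = s₀ + s₁ + s₂ := by
    rw [weilTwoPrimeCellsT80, powSum_append, powSum_append, hs₀, hs₁, hs₂]
  rw [hr, hs]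
  exact hlit

/-! ## The one-prime cell checks of `cellsT80fp` from the two-prime kernel facts -/

/-- A list of two-prime cells passing `TPDCell.checkZ` passes `FPDCell.checkZ` on its inner cells. [folklore] -/
theorem all_fp_checkZ_of_all_checkZ {p j : ℕ} {L : List TPDCell} (h : (L.all fun c ↦ c.checkZ p j) = true) :
    ((L.map TPDCell.fp).all fun c ↦ c.checkZ p j) = true := by
  rw [List.all_map, List.all_eq_true]
  rw [List.all_eq_true] at h
  intro c hc
  exact (TPDCell.checkZ_spec (h c hc)).1

/-- The one-prime level at `T = 80`: the largest multiple of `2^-40` with `wL + (√2 log 2)_hi ≤ wLoZ 120 2560 5 40000`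
(`≈ 2.708614800034`, slack `1.7·10⁻¹³`). [folklore] -/
def levelT80fp : ℚ := 744538366951/274877906944

/-- All inner cells of the two-prime chain pass the first-prime integer cell check at `prec = 120`, `j = 5`
(from the tree's kernel facts for the two-prime cells). [folklore] -/
theorem all_checkZ_cellsT80fp : (cellsT80fp.all fun c ↦ c.checkZ 120 5) = true := by
  have hall : (weilTwoPrimeCellsT80.all fun c ↦ c.checkZ 120 5) = true := by
    simp only [weilTwoPrimeCellsT80, List.all_append, checkCells_weilTwoPrimeCellsT80C0,
      checkCells_weilTwoPrimeCellsT80C1, checkCells_weilTwoPrimeCellsT80C2, Bool.and_self]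
  unfold cellsT80fp
  exact all_fp_checkZ_of_all_checkZ hall

/-- The inner cells chain from `0` to `80` (cheap kernel check). [folklore] -/
theorem checkChain_cellsT80fp : checkChain₂ cellsT80fp 0 80 = true := by
  decide +kernel

set_option maxHeartbeats 0 in
/-- The ONE-prime level test at `T = 80` against the integer digamma bound (one evaluation of `wLoZ`). [folklore] -/
theorem checkLevel_cellsT80fp :
    decide (levelT80fp + cZeroFI.hiQ ≤ wLoZ 120 2560 5 40000) = true := by
  decide +kernel

/-- **`checkCells₃ = true` for the one-prime chain `cellsT80fp` at level `levelT80fp`** (assembled). [folklore] -/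
theorem checkCells₃_cellsT80fp : checkCells₃ 120 5 levelT80fp 80 40000 cellsT80fp = true := by
  unfold checkCells₃
  rw [checkChain_cellsT80fp, all_checkZ_cellsT80fp, dyNumT_weilTwoPrimeCellsT80, checkLevel_cellsT80fp]
  have hd := checkTdy_weilTwoPrimeCellsT80
  rw [dyNumT_weilTwoPrimeCellsT80] at hd
  rw [Bool.true_and, Bool.true_and]
  simpa using hd

end Summit.RiemannHypothesis.RiemannHypothesis.Theorems.SemilocalCert554
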